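/-
Copyright (c) 2026 the pub-hodgecm-mathlib formalisation cell (harness21).  Prover seat hodgecm-mathlib-F0P3a-p01 (g35), Track A «(D-RAM) FOUR-FRAME» helper lane
(`--supports stmt-HodgeConjecture-24833 --as helper`); STAGE-1b count-neutral brick «THE DIAGONAL LEVEL TOKEN HOLDS INSIDE THE AXIS REGION» (prep for the (L-lev)∕(L-sq)
producers; my `F0/P3a/F0P3a-p01/g35/laws/STRATA-1b-levels.v1.F0P3ap01g35.md` (S1)(S2), lower-bound half).  2026-09-04.
-/
import Summits.HodgeConjecture.HodgeConjecture.Theorems.F0P3cDyRamLevelTokenHNF        -- ★ (LH4-p09 (g8)) `latticeInLevel_iff_forall_smul_mulVec_mem`; brings ★ census DEFS `LatticeInLevel`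
import Summits.HodgeConjecture.HodgeConjecture.Theorems.F0P3cDyRamDiagonalStrataDefs     -- ★ Stage-B `HasAxis`, `stratum`, `IsNormalisedLattice`, `normalisedStableLattices`
import HarnessLib

/-!
# Crux `H413`, line LH4 «(D-RAM) FOUR-FRAME» — STAGE-1b brick: THE DIAGONAL LEVEL TOKEN HOLDS ON EVERY STAGE-B STRATUM INSIDE THE AXIS REGION

Cell `hodgecm-mathlib` (D-0151), FLOOR 0, crux item H413 = `stmt-HodgeConjecture-24833`, route of record `HCCMUnconditional`; squads F0∕P3a + F0∕P3c∕LH4; helper lane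
(count-neutral).  THEOREMS ONLY (no `def`, no instance, no notation, no `sorry`, default heartbeats).  Consumers: the (L-lev)∕(L-sq)∕(L-T+ at `m_c`) producers of the
STAGE-1b directive — their census laws are sums of ★ Stage-B stratum weights over the strata on which the level token of `T − 1 = diag(α−1, β−1, 0)` (and of its square)
holds (F0P3a-p01 (g35) STRATA memo: on the fixed type-0 set the token is CONSTANT per stratum; (S1) `sqlev = min(2v(α−1) − a₀, 2v(β−1) − a₁)`, (S2) off the tube
`lev = min(v(α−1) − a₀, v(β−1) − a₁)`, model axis letters).  THIS FILE PROVES THE «≥» HALF OF (S1)∕(S2) FOR EVERY STRATUM, with no tube exception: for a lattice `M` whose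
coordinates are integral (`IsNormalisedLattice`, first conjunct) and whose axis vector is `a` (`HasAxis ϖ M a`), and ANY diagonal operator `diag(e)`:
`|e_i| ≤ |ϖ|^{ℓ + a_i}` for all `i`  ⟹  `diag(e)·M ⊆ ϖ^ℓ·M`.  Proof: `ϖ^{−ℓ}diag(e)w = Σ_i (ϖ^{−ℓ}e_i w_i)·e_i` and each summand is on the `i`-th axis at depth
`≥ a_i` (`|w_i| ≤ 1`), hence in `M` by `HasAxis`.  So the strata with `a₀ ≤ v(α−1) − ℓ`, `a₁ ≤ v(β−1) − ℓ` (resp. `≤ 2v(·) − ℓ` for the square) are INSIDE the level piece;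
(S1)∕(S2) say these are ALL of them except the `G₁(ρ, 2)` tube bonus — the converse is the producers' content.

* `single_smul_mem_of_hasAxis` — `|t| ≤ |ϖ|^{a_i} ⇒ t·e_i ∈ M` (one direction of ★ `HasAxis`, as a lemma);
* `diagonal_mulVec_eq_sum_single` — `diag(e)·w = Σ_i Pi.single i (e_i w_i)`;
* `smul_diagonal_mulVec_mem_of_hasAxis` — the pointwise statement; HEAD `latticeInLevel_diagonal_of_hasAxis`;
* `latticeInLevel_diagonal_of_mem_stratum` — the same read on a ★ Stage-B stratum `stratum σ ϖ T a`;
* `latticeInLevel_diagonal_sq_of_hasAxis` — the square `diag(e)·diag(e) = diag(e²)` instance (`|e_i|² ≤ |ϖ|^{ℓ + a_i}`).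
HONEST LABEL.  Count-neutral (`--supports`): no tier-0 row is paid here; the census laws stay PROVER TARGETS; `HC_CM` is proved only modulo the 7 printed citations (2 remaining
named inputs: hLiu418 = `stmt-HodgeConjecture-24832`, h413 = `stmt-HodgeConjecture-24833`) until rung 0 closes.
-/

set_option autoImplicit false

namespace Summit.HodgeConjecture.HodgeConjecture.Cruxes.H413.F0P3cDyRamLevelTokenAxisBound

open Literature.NumberTheory.Automorphic Literature.NumberTheory.Automorphic.HermitianLattice
open Literature.NumberTheory.Automorphic.UnitaryLatticeTree
open Summit.HodgeConjecture.HodgeConjecture.Cruxes.H413.F0P3cDyRamFourFrameCensusDefs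
open Summit.HodgeConjecture.HodgeConjecture.Cruxes.H413.F0P3cDyRamLevelTokenHNF
open Summit.HodgeConjecture.HodgeConjecture.Cruxes.H413.F0P3cDyRamDiagonalTorusDefs
open Summit.HodgeConjecture.HodgeConjecture.Cruxes.H413.F0P3cDyRamDiagonalStrataDefs
open scoped Valued WithZero Matrix MatrixGroups

variable {K : Type} [Field K] [Valued K ℤᵐ⁰]

/-- One direction of ★ `HasAxis`: a vector on the `i`-th axis at depth `≥ a_i` lies in `M`. [cite: Serre1980Trees, Ch. II §1.1] -/
theorem single_mem_of_hasAxis {ϖ : K} {M : Submodule 𝒪[K] (Fin 3 → K)} {a : Fin 3 → ℕ} (ha : HasAxis ϖ M a) (i : Fin 3) {t : K}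
    (ht : Valued.v t ≤ Valued.v ϖ ^ (a i)) : (Pi.single i t : Fin 3 → K) ∈ M :=
  (ha i t).2 ht

omit [Valued K ℤᵐ⁰] in
/-- `diag(e)·w = Σ_i Pi.single i (e_i·w_i)`. [cite: Serre1980Trees, Ch. II §1.1] -/
theorem diagonal_mulVec_eq_sum_single (e w : Fin 3 → K) :
    Matrix.diagonal e *ᵥ w = ∑ i : Fin 3, (Pi.single i (e i * w i) : Fin 3 → K) := by
  ext j
  rw [Matrix.mulVec_diagonal, Finset.sum_apply, Finset.sum_eq_single j (fun i _ hij => Pi.single_eq_of_ne' hij _) (fun h => (h (Finset.mem_univ j)).elim),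
    Pi.single_eq_same]

/-- **POINTWISE**: if every coordinate of `w` is integral, `M` has axis vector `a` and `|e_i| ≤ |ϖ|^{ℓ + a_i}` for all `i`, then `(ϖ^{−ℓ}·diag(e))·w ∈ M`.
[cite: Serre1980Trees, Ch. II §1.1] [cite: Kottwitz1986BaseChangeUnits, §1 pp. 240–241] -/
theorem smul_diagonal_mulVec_mem_of_hasAxis {ϖ : K} (hϖ : ϖ ≠ 0) {M : Submodule 𝒪[K] (Fin 3 → K)} {a : Fin 3 → ℕ} (ha : HasAxis ϖ M a) (ℓ : ℕ) (e : Fin 3 → K)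
    (he : ∀ i, Valued.v (e i) ≤ Valued.v ϖ ^ (ℓ + a i)) {w : Fin 3 → K} (hw : ∀ i, Valued.v (w i) ≤ 1) :
    ((ϖ ^ ℓ)⁻¹ • Matrix.diagonal e) *ᵥ w ∈ M := by
  rw [Matrix.smul_mulVec, diagonal_mulVec_eq_sum_single, Finset.smul_sum]
  refine Submodule.sum_mem M fun i _ => ?_
  rw [← Pi.single_smul', smul_eq_mul]
  refine single_mem_of_hasAxis ha i ?_
  have hϖℓ : Valued.v (ϖ ^ ℓ) ≠ 0 := (Valuation.ne_zero_iff _).2 (pow_ne_zero ℓ hϖ)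
  rw [map_mul, map_mul, map_inv₀, map_pow]
  calc (Valued.v ϖ ^ ℓ)⁻¹ * (Valued.v (e i) * Valued.v (w i))
      ≤ (Valued.v ϖ ^ ℓ)⁻¹ * (Valued.v ϖ ^ (ℓ + a i) * 1) :=
        mul_le_mul_right (mul_le_mul' (he i) (hw i)) _
    _ = Valued.v ϖ ^ (a i) := by
        rw [mul_one, pow_add, ← mul_assoc, inv_mul_cancel₀ (by rwa [map_pow] at hϖℓ), one_mul]

/-- **HEAD — THE DIAGONAL LEVEL TOKEN HOLDS INSIDE THE AXIS REGION**: for a lattice `M` with integral coordinates and axis vector `a` (★ `HasAxis ϖ M a`) and a diagonal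
operator `diag(e)` with `|e_i| ≤ |ϖ|^{ℓ + a_i}` for every `i`: `diag(e)·M ⊆ ϖ^ℓ·M` (★ census DEFS `LatticeInLevel ϖ ℓ (diagonal e) M`).  With `e = (α−1, β−1, 0)`: every Stage-B
stratum with `a₀ + ℓ ≤ v(α−1)`, `a₁ + ℓ ≤ v(β−1)` lies INSIDE the level-`ℓ` piece (the «≥» half of the STRATA memo's (S2); no tube exception in this direction).
[cite: Kottwitz1986BaseChangeUnits, §1 pp. 240–241] [cite: Serre1980Trees, Ch. II §1.1] -/
theorem latticeInLevel_diagonal_of_hasAxis {ϖ : K} (hϖ : ϖ ≠ 0) {M : Submodule 𝒪[K] (Fin 3 → K)} (hint : ∀ x ∈ M, ∀ i, Valued.v (x i) ≤ 1) {a : Fin 3 → ℕ}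
    (ha : HasAxis ϖ M a) (ℓ : ℕ) (e : Fin 3 → K) (he : ∀ i, Valued.v (e i) ≤ Valued.v ϖ ^ (ℓ + a i)) :
    LatticeInLevel ϖ ℓ (Matrix.diagonal e) M :=
  (latticeInLevel_iff_forall_smul_mulVec_mem hϖ ℓ (Matrix.diagonal e) M).2 fun w hw =>
    smul_diagonal_mulVec_mem_of_hasAxis hϖ ha ℓ e he (hint w hw)

/-- The same read on a ★ Stage-B STRATUM: every `M ∈ stratum σ ϖ T a` (normalised, dualisable, axis vector `a`) satisfies the diagonal level token `diag(e)·M ⊆ ϖ^ℓ·M` as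
soon as `|e_i| ≤ |ϖ|^{ℓ + a_i}` for all `i` — the token is TRUE on the whole stratum (one half of the STRATA memo's purity (S0) + region (S2)).
[cite: Kottwitz1986BaseChangeUnits, §1 pp. 240–241] -/
theorem latticeInLevel_diagonal_of_mem_stratum {ϖ : K} (hϖ : ϖ ≠ 0) (σ : K →+* K) (T : GL (Fin 3) K) {a : Fin 3 → ℕ} {M : Submodule 𝒪[K] (Fin 3 → K)}
    (hM : M ∈ stratum σ ϖ T a) (ℓ : ℕ) (e : Fin 3 → K) (he : ∀ i, Valued.v (e i) ≤ Valued.v ϖ ^ (ℓ + a i)) :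
    LatticeInLevel ϖ ℓ (Matrix.diagonal e) M :=
  latticeInLevel_diagonal_of_hasAxis hϖ (fun x hx i => (hM.1.2.2 i).1 x hx) hM.2.2 ℓ e he

/-- **THE SQUARE TOKEN**: `diag(e)·diag(e) = diag(e²)`, so `|e_i|² ≤ |ϖ|^{ℓ + a_i}` for all `i` gives `(diag(e)·diag(e))·M ⊆ ϖ^ℓ·M` — with `e = (α−1, β−1, 0)` every stratum
with `a₀ + ℓ ≤ 2v(α−1)`, `a₁ + ℓ ≤ 2v(β−1)` lies INSIDE the square-level-`ℓ` piece (the «≥» half of (S1)). [cite: Kottwitz1986BaseChangeUnits, §1 pp. 240–241] -/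
theorem latticeInLevel_diagonal_sq_of_hasAxis {ϖ : K} (hϖ : ϖ ≠ 0) {M : Submodule 𝒪[K] (Fin 3 → K)} (hint : ∀ x ∈ M, ∀ i, Valued.v (x i) ≤ 1) {a : Fin 3 → ℕ}
    (ha : HasAxis ϖ M a) (ℓ : ℕ) (e : Fin 3 → K) (he : ∀ i, Valued.v (e i) * Valued.v (e i) ≤ Valued.v ϖ ^ (ℓ + a i)) :
    LatticeInLevel ϖ ℓ (Matrix.diagonal e * Matrix.diagonal e) M := by
  rw [Matrix.diagonal_mul_diagonal]
  exact latticeInLevel_diagonal_of_hasAxis hϖ hint ha ℓ _ fun i => by rw [map_mul]; exact he i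

end Summit.HodgeConjecture.HodgeConjecture.Cruxes.H413.F0P3cDyRamLevelTokenAxisBound
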